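import Literature.Probability.Percolation.FourArmInnerBoundaryBound
import Literature.Probability.Percolation.FourArmPivotalSumLayer
import HarnessLib

/-!
# Pivotal sites of the four-arm event, uniformly in the inner radius: per-site bounds (proofs only)

Topic `Literature/Probability/Percolation`; family `crit-perc`. PROOFS ONLY (no definition, no
named fact). Per-site estimates for `P_t(v pivotal for armEvent ![T,F,T,F] r₀ N)` whose constants
do not depend on the inner radius `r₀` of the event (P. Nolin, *Near-critical percolation in two
dimensions*, EJP 13 (2008), §6.2, proof of Thm. 27, Cases 1–3, UNIFORM in `n ≤ N`
[arXiv 0711.4948: Thm. 26]; W. Werner, PCMI 2009, Lecture 6, §5). The tree's bounds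
(`FourArmPivotalSumBulk.lean`, `FourArmPivotalSumLayer.lean`) convert the local four-arm factor
`π̂_t(r, 2^l)` through the event's own inner radius (`π̂_t(r, 2^l) ≤ π̂_t(r₀, 2^l) ≤ … π̂_t(r₀, N)`,
which needs `2^l ≫ r₀`); here the conversion is done at the small reference radius `r` of the
kernel hypotheses, so that every bound reads `cst · weight · π̂_t(r, N) · π̂_t(r₀, N)` with `cst`
depending on `c_Q, c_L, C_A, C_H, α, β, r, l₁` only:

* `unif_pivotal_core`, `unif_pivotal_bulk` — bulk sites `|v|_𝕋 ≥ 16 r₀` (the three annuli,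
  quasi-multiplicativity at the inner radius `r₀` merging the inner and outer four arms);
* `unif_outer_fourArm_le` — `π̂_t(R₂, N) ≤ (64/(c_Q c_L)) π̂_t(r₀, N)` for `R₂ ≤ 32 r₀`;
* `unif_pivotal_near` — sites `r₀ + 2·2^l ≤ |v|_𝕋 ≤ 20 r₀` (inner four arms dropped, local scale
  `2^l` below the distance to `∂Λ_{r₀}`);
* `unif_pivotal_innerDeep`, `unif_pivotal_innerShallow` — the inner boundary layer away from the
  corners of `Λ_{r₀}` (`FourArmInnerBoundaryBound.lean`: local factor × mixed half-plane pair ×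
  outer four arms, resp. the pair × outer four arms);
* `unif_pivotal_deep`, `unif_pivotal_middle` — the outer boundary layer (`fourArm_pivotal_bound_deep`,
  `…_middle` with the conversion at `r`; the shallow outer shells are `fourArm_pivotal_bound_shallow`
  verbatim).

These serve the pivotal sum `Σ_v P_t(v pivotal) ≤ K · N² π̂_t(r, N) · π̂_t(r₀, N)` uniformly in
`r₀` (sequel), the input of a bootstrap argument for the near-critical comparison of the two
cyclic arrangements of four arms (`FourArmStabilityFromAltPattern.lean`, hypothesis `(Br)`).

## References

* P. Nolin, Near-critical percolation in two dimensions, *Electron. J. Probab.* 13 (2008), §4.6,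
  §6.2 (proof of Thm. 27, Cases 1–3) [arXiv 0711.4948: Thm. 26] [Nolin2008].
* W. Werner, *Lectures on two-dimensional critical percolation*, IAS/Park City Math. Ser. 16
  (2009), Lecture 6, §5 and proof of Lemma 6.2 (boundary contributions) [WernerPCMI2009].
* H. Kesten, Scaling relations for 2D-percolation, *Comm. Math. Phys.* 109 (1987), Lemma 8
  [KestenScalingCMP1987].

Tree: `measureReal_isPivotal_fourArm_le` (`FourArmPivotalBound.lean`), `local_factor_le`
(`FourArmPivotalLocal.lean`), `fourArmProbAt_le_ratio_mul` (`OneArmPivotalSum.lean`),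
`fourArmProbAt_inner_le`, `fourArm_pivotal_bound_shallow` (`FourArmPivotalSumLayer.lean`),
`measureReal_isPivotal_fourArm_boundary_le` (`FourArmPivotalBoundary.lean`),
`measureReal_isPivotal_fourArm_innerBoundary_le/_two_le` (`FourArmInnerBoundaryBound.lean`),
`layer_ratio_le` (`OneArmPivotalLayer.lean`), `fourArmProbAt_anti/mono_inner/nonneg/le_one`.

Used by: `FourArmPivotalUniformSum.lean` (the shell sums and `exists_unif_pivotalSum_le`), then
`FourArmBridgeBootstrap.lean` (the bootstrap of the near-critical arrangement bridge from its critical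
case) and `WernerPivotalFromArmSeparation.lean` (the order-free facts of Werner's Lecture 6 from the two
arm-separation displays).
-/

noncomputable section

open MeasureTheory Set Finset

namespace Literature.Probability.Percolation

open LatticeModels

section Regimes

variable {t : unitInterval} {N r r₀ : ℕ} {cQ cL CA CH α β : ℝ}

/-! ### Bulk sites -/

/-- **Bulk sites, uniformly in the inner radius** (`8·2^l ≤ |v|_𝕋 = k`, `16 r₀ ≤ k`,
`k + 2^{l+1} + 9 ≤ N`, `l ≥ l₁ + 2`): the three annuli of `measureReal_isPivotal_fourArm_le`
(`R₁ = k - 2^l - 1`, `R₂ = k + 2^l + 1`), quasi-multiplicativity at the inner radius `r₀`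
(`R = ⌊R₂/4⌋ + 1`), the local factors `≤ 2 K_L π̂_t(r, 2^l)` (`local_factor_le`) and the conversion
`π̂_t(r, 2^l) ≤ (4/(c_Q c_L)) (N/2^l)^{2-β} π̂_t(r, N)` at the reference radius `r`
(`fourArmProbAt_le_ratio_mul`). [cite: Nolin2008, §6.2, proof of Thm. 27, Case 3 (arXiv 0711.4948: Thm. 26)] [cite: WernerPCMI2009, Lecture 6, §5 ("c Σ_x π̂_p(‖x‖/2)² π̂_p(2‖x‖, n)")] -/

theorem unif_pivotal_core (hcQ : 0 < cQ) (hcL : 0 < cL) (hCA : 0 ≤ CA) (hα : 0 < α)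
    (hβ : 0 < β) (hβ2 : β ≤ 2) (hr2 : 2 ≤ r) (hrr₀ : r ≤ r₀)
    (hQ : ∀ r' R S : ℕ, r ≤ r' → 16 * r' < 4 * R → 4 * R < S → S ≤ N →
      cQ * (fourArmProbAt t r' R * fourArmProbAt t (4 * R) S) ≤ fourArmProbAt t r' S)
    (hL : ∀ m n : ℕ, r ≤ m → m ≤ n → n ≤ N → cL * ((m : ℝ) / n) ^ (2 - β) ≤ fourArmProbAt t m n)
    (hA : ∀ (c : Bool) (n M : ℕ), 1 ≤ n → n ≤ M → M ≤ N →
      (triSitePercolation t).real (armEvent ![c] n M) ≤ CA * ((n : ℝ) / M) ^ α)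
    {l₁ : ℕ} (hl₁ : 1 ≤ l₁) (hl₁r : 16 * r + 1 ≤ 2 ^ (l₁ + 1)) (hl₁r' : r ≤ 2 ^ (l₁ - 1))
    {v : Site 2} {k l : ℕ} (hk : triNorm v = k) (hkl : 8 * 2 ^ l ≤ k)
    (hll₁ : l₁ + 2 ≤ l) (hkr₀ : 16 * r₀ ≤ k) (hkN : k + 2 * 2 ^ l + 9 ≤ N) :
    (triSitePercolation t).real {ω | IsPivotal (armEvent ![true, false, true, false] r₀ N) v ω} ≤
      (2 * (8 / (cQ * cL) * (1 + CA) + CA +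
          CA / cQ * (1 + 1 / (cL * ((r : ℝ) / (2 ^ (l₁ - 1) : ℕ)) ^ (2 - β))) *
            ((2 : ℝ) ^ α / ((2 : ℝ) ^ α - 1))) / cQ * (4 / (cQ * cL))) *
        ((N : ℝ) / (2 ^ l : ℕ)) ^ (2 - β) * (fourArmProbAt t r N * fourArmProbAt t r₀ N) := by
  classical
  set KL : ℝ := 8 / (cQ * cL) * (1 + CA) + CA +
    CA / cQ * (1 + 1 / (cL * ((r : ℝ) / (2 ^ (l₁ - 1) : ℕ)) ^ (2 - β))) *
      ((2 : ℝ) ^ α / ((2 : ℝ) ^ α - 1)) with hKL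
  have hr0 : (0 : ℝ) < r := by exact_mod_cast (show 0 < r by omega)
  have hy1 : 1 < (2 : ℝ) ^ α := Real.one_lt_rpow (by norm_num) hα
  have hKL0 : 0 ≤ KL := by
    rw [hKL]
    have : 0 < cL * ((r : ℝ) / (2 ^ (l₁ - 1) : ℕ)) ^ (2 - β) :=
      mul_pos hcL (Real.rpow_pos_of_pos (div_pos hr0 (by positivity)) _)
    have : 0 ≤ (2 : ℝ) ^ α / ((2 : ℝ) ^ α - 1) := div_nonneg (by positivity) (by linarith)
    positivity
  -- radii
  obtain ⟨M, hM⟩ : ∃ M : ℕ, M = 2 ^ l := ⟨_, rfl⟩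
  have hM1 : 1 ≤ M := by rw [hM]; exact Nat.one_le_two_pow
  have hl1 : 1 ≤ l := by omega
  have h2l : 32 * r + 2 ≤ 2 ^ l := by
    have h1 : 2 ^ (l₁ + 2) ≤ 2 ^ l := Nat.pow_le_pow_right (by norm_num) hll₁
    have h2 : 2 ^ (l₁ + 2) = 2 * 2 ^ (l₁ + 1) := by rw [pow_succ]; ring
    omega
  have hN : 20 * r + 10 ≤ N := by omega
  set R₁ : ℕ := k - M - 1 with hR₁
  set R₂ : ℕ := k + M + 1 with hR₂
  have hkv : (triNorm v : ℤ) = k := hk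
  -- the per-site estimate with the three annuli
  have hcastM : ((2 : ℤ) ^ l) = ((M : ℕ) : ℤ) := by rw [hM]; push_cast; ring
  have h3 := measureReal_isPivotal_fourArm_le t (r₀ := r₀) (N := N) (v := v) (R₁ := R₁) (R₂ := R₂)
    hl1 (by rw [hkv, hcastM]; omega) (by rw [hkv, hcastM]; omega)
    (by omega) (by rw [hkv, hcastM]; omega) (by rw [hkv, hcastM]; omega)
    (by omega)
  -- the local factors
  have hMN : 2 ^ (l + 2) ≤ N := by
    have : 2 ^ (l + 2) = 4 * 2 ^ l := by rw [pow_add]; ring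
    omega
  have hloc : ∀ c : Bool, fourArmProbAt t 1 (2 ^ (l - 1)) +
      (triSitePercolation t).real (armEvent ![c, c, c, c, !c, !c] 2 (2 ^ l)) +
      ∑ l' ∈ Finset.Ico 1 l, fourArmProbAt t 1 (2 ^ (l' - 1)) *
        (triSitePercolation t).real (armEvent ![c, c, c, c, !c, !c] (2 ^ (l' + 1)) (2 ^ l)) ≤
      KL * fourArmProbAt t r (2 ^ l) := fun c =>
    local_factor_le hcQ hcL hCA hα hβ hr2 hQ hL hA hl₁ hl₁r hl₁r' c hll₁ hMN
  have hsum : ∑ c : Bool, (fourArmProbAt t 1 (2 ^ (l - 1)) +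
      (triSitePercolation t).real (armEvent ![c, c, c, c, !c, !c] 2 (2 ^ l)) +
      ∑ l' ∈ Finset.Ico 1 l, fourArmProbAt t 1 (2 ^ (l' - 1)) *
        (triSitePercolation t).real (armEvent ![c, c, c, c, !c, !c] (2 ^ (l' + 1)) (2 ^ l))) ≤
      2 * KL * fourArmProbAt t r (2 ^ l) := by
    rw [Fintype.sum_bool]
    have h₁ := hloc true
    have h₂ := hloc false
    linarith
  -- merging the inner and outer annuli: `π̂(r₀, R₁) π̂(R₂, N) ≤ π̂(r₀, N)/cQ`
  set R : ℕ := R₂ / 4 + 1 with hRdef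
  have hRR₁ : R ≤ R₁ := by omega
  have hRR₂ : R₂ ≤ 4 * R := by omega
  have h4RN : 4 * R < N := by omega
  have h16 : 16 * r₀ < 4 * R := by omega
  have hio : fourArmProbAt t r₀ R₁ * fourArmProbAt t R₂ N ≤ fourArmProbAt t r₀ N / cQ := by
    have hq := hQ r₀ R N hrr₀ h16 h4RN le_rfl
    rw [le_div_iff₀ hcQ]
    calc fourArmProbAt t r₀ R₁ * fourArmProbAt t R₂ N * cQ
        = cQ * (fourArmProbAt t r₀ R₁ * fourArmProbAt t R₂ N) := by ring
      _ ≤ cQ * (fourArmProbAt t r₀ R * fourArmProbAt t (4 * R) N) := by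
          refine mul_le_mul_of_nonneg_left (mul_le_mul ?_ ?_ (fourArmProbAt_nonneg _ _ _)
            (fourArmProbAt_nonneg _ _ _)) hcQ.le
          · exact fourArmProbAt_anti t (by omega) hRR₁
          · exact fourArmProbAt_mono_inner t hRR₂ h4RN.le
      _ ≤ fourArmProbAt t r₀ N := hq
  -- the local four-arm probability against `π̂(r₀, N)`
  have hQr : ∀ R S : ℕ, 16 * r < 4 * R → 4 * R < S → S ≤ N →
      cQ * (fourArmProbAt t r R * fourArmProbAt t (4 * R) S) ≤ fourArmProbAt t r S :=
    fun R S h1 h2 h3 => hQ r R S le_rfl h1 h2 h3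
  have hπr : fourArmProbAt t r (2 ^ l) ≤ 4 / (cQ * cL) * ((N : ℝ) / (2 ^ l : ℕ)) ^ (2 - β) *
      fourArmProbAt t r N :=
    fourArmProbAt_le_ratio_mul (rL := r) hcQ hcL hβ hβ2 hQr hL hN (by omega)
      (d := 2 ^ l) (by omega) (by omega) (by omega)
  -- assemble
  have hπN := fourArmProbAt_nonneg t r₀ N
  have hW : 0 ≤ ((N : ℝ) / (2 ^ l : ℕ)) ^ (2 - β) := by positivity
  calc (triSitePercolation t).real {ω | IsPivotal (armEvent ![true, false, true, false] r₀ N) v ω}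
      ≤ fourArmProbAt t r₀ R₁ * fourArmProbAt t R₂ N * (2 * KL * fourArmProbAt t r (2 ^ l)) :=
        h3.trans (mul_le_mul_of_nonneg_left hsum
          (mul_nonneg (fourArmProbAt_nonneg _ _ _) (fourArmProbAt_nonneg _ _ _)))
    _ ≤ fourArmProbAt t r₀ N / cQ *
          (2 * KL * (4 / (cQ * cL) * ((N : ℝ) / (2 ^ l : ℕ)) ^ (2 - β) * fourArmProbAt t r N)) := by
        refine mul_le_mul hio ?_
          (mul_nonneg (mul_nonneg (by norm_num) hKL0) (fourArmProbAt_nonneg _ _ _))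
          (div_nonneg hπN hcQ.le)
        exact mul_le_mul_of_nonneg_left hπr (by positivity)
    _ = 2 * KL / cQ * (4 / (cQ * cL)) * ((N : ℝ) / (2 ^ l : ℕ)) ^ (2 - β) *
          (fourArmProbAt t r N * fourArmProbAt t r₀ N) := by
        field_simp


/-- **Bulk sites, uniformly in the inner radius** (`8·2^l ≤ |v|_𝕋 = k < 16·2^l`, `16 r₀ ≤ k`,
`2k ≤ N`): `unif_pivotal_core` with `(N/2^l)^{2-β} ≤ 256 (N/k)^{2-β}`. [cite: Nolin2008, §6.2, proof of Thm. 27, Case 3 (arXiv 0711.4948: Thm. 26)] [cite: WernerPCMI2009, Lecture 6, §5] -/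

theorem unif_pivotal_bulk (hcQ : 0 < cQ) (hcL : 0 < cL) (hCA : 0 ≤ CA) (hα : 0 < α)
    (hβ : 0 < β) (hβ2 : β ≤ 2) (hr2 : 2 ≤ r) (hrr₀ : r ≤ r₀)
    (hQ : ∀ r' R S : ℕ, r ≤ r' → 16 * r' < 4 * R → 4 * R < S → S ≤ N →
      cQ * (fourArmProbAt t r' R * fourArmProbAt t (4 * R) S) ≤ fourArmProbAt t r' S)
    (hL : ∀ m n : ℕ, r ≤ m → m ≤ n → n ≤ N → cL * ((m : ℝ) / n) ^ (2 - β) ≤ fourArmProbAt t m n)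
    (hA : ∀ (c : Bool) (n M : ℕ), 1 ≤ n → n ≤ M → M ≤ N →
      (triSitePercolation t).real (armEvent ![c] n M) ≤ CA * ((n : ℝ) / M) ^ α)
    {l₁ : ℕ} (hl₁ : 1 ≤ l₁) (hl₁r : 16 * r + 1 ≤ 2 ^ (l₁ + 1)) (hl₁r' : r ≤ 2 ^ (l₁ - 1))
    {v : Site 2} {k l : ℕ} (hk : triNorm v = k) (hkl : 8 * 2 ^ l ≤ k) (hkl' : k < 16 * 2 ^ l)
    (hll₁ : l₁ + 2 ≤ l) (hkr₀ : 16 * r₀ ≤ k) (hkN : 2 * k ≤ N) :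
    (triSitePercolation t).real {ω | IsPivotal (armEvent ![true, false, true, false] r₀ N) v ω} ≤
      (2 * (8 / (cQ * cL) * (1 + CA) + CA +
          CA / cQ * (1 + 1 / (cL * ((r : ℝ) / (2 ^ (l₁ - 1) : ℕ)) ^ (2 - β))) *
            ((2 : ℝ) ^ α / ((2 : ℝ) ^ α - 1))) / cQ * (1024 / (cQ * cL))) *
        ((N : ℝ) / max 1 (triNorm v : ℝ)) ^ (2 - β) * (fourArmProbAt t r N * fourArmProbAt t r₀ N) := by
  have h := unif_pivotal_core hcQ hcL hCA hα hβ hβ2 hr2 hrr₀ hQ hL hA hl₁ hl₁r hl₁r' hk hkl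
    hll₁ hkr₀ (by omega)
  set KL : ℝ := 8 / (cQ * cL) * (1 + CA) + CA +
    CA / cQ * (1 + 1 / (cL * ((r : ℝ) / (2 ^ (l₁ - 1) : ℕ)) ^ (2 - β))) *
      ((2 : ℝ) ^ α / ((2 : ℝ) ^ α - 1)) with hKL
  have hr0 : (0 : ℝ) < r := by exact_mod_cast (show 0 < r by omega)
  have hy1 : 1 < (2 : ℝ) ^ α := Real.one_lt_rpow (by norm_num) hα
  have hKL0 : 0 ≤ KL := by
    rw [hKL]
    have : 0 < cL * ((r : ℝ) / (2 ^ (l₁ - 1) : ℕ)) ^ (2 - β) :=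
      mul_pos hcL (Real.rpow_pos_of_pos (div_pos hr0 (by positivity)) _)
    have : 0 ≤ (2 : ℝ) ^ α / ((2 : ℝ) ^ α - 1) := div_nonneg (by positivity) (by linarith)
    positivity
  have hN0 : (0 : ℝ) < N := by exact_mod_cast (show 0 < N by omega)
  have hk0 : (0 : ℝ) < k := by exact_mod_cast (show 0 < k by omega)
  have hmax : max 1 (triNorm v : ℝ) = k := by
    rw [hk]; push_cast; exact max_eq_right (by exact_mod_cast (show 1 ≤ k by omega))
  rw [hmax]
  have hexp : (0 : ℝ) ≤ 2 - β := by linarith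
  have hpow : ((N : ℝ) / (2 ^ l : ℕ)) ^ (2 - β) ≤ 256 * ((N : ℝ) / k) ^ (2 - β) := by
    have hle : (N : ℝ) / (2 ^ l : ℕ) ≤ 16 * ((N : ℝ) / k) := by
      rw [mul_div_assoc', div_le_div_iff₀ (by positivity) hk0]
      have : (k : ℝ) ≤ 16 * ((2 ^ l : ℕ) : ℝ) := by exact_mod_cast hkl'.le
      nlinarith [hN0]
    calc ((N : ℝ) / (2 ^ l : ℕ)) ^ (2 - β) ≤ (16 * ((N : ℝ) / k)) ^ (2 - β) :=
          Real.rpow_le_rpow (by positivity) hle hexp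
      _ = (16 : ℝ) ^ (2 - β) * ((N : ℝ) / k) ^ (2 - β) := Real.mul_rpow (by norm_num) (by positivity)
      _ ≤ 256 * ((N : ℝ) / k) ^ (2 - β) := by
          apply mul_le_mul_of_nonneg_right _ (by positivity)
          calc (16 : ℝ) ^ (2 - β) ≤ (16 : ℝ) ^ (2 : ℝ) :=
                Real.rpow_le_rpow_of_exponent_le (by norm_num) (by linarith)
            _ = 256 := by norm_num
  have hππ : 0 ≤ fourArmProbAt t r N * fourArmProbAt t r₀ N :=
    mul_nonneg (fourArmProbAt_nonneg _ _ _) (fourArmProbAt_nonneg _ _ _)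
  calc (triSitePercolation t).real {ω | IsPivotal (armEvent ![true, false, true, false] r₀ N) v ω}
      ≤ 2 * KL / cQ * (4 / (cQ * cL)) * ((N : ℝ) / (2 ^ l : ℕ)) ^ (2 - β) *
          (fourArmProbAt t r N * fourArmProbAt t r₀ N) := h
    _ ≤ 2 * KL / cQ * (4 / (cQ * cL)) * (256 * ((N : ℝ) / k) ^ (2 - β)) *
          (fourArmProbAt t r N * fourArmProbAt t r₀ N) := by
        apply mul_le_mul_of_nonneg_right _ hππ
        exact mul_le_mul_of_nonneg_left hpow (by positivity)
    _ = 2 * KL / cQ * (1024 / (cQ * cL)) * ((N : ℝ) / k) ^ (2 - β) *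
          (fourArmProbAt t r N * fourArmProbAt t r₀ N) := by ring


/-! ### The outer four arms from a radius comparable to `r₀` -/

/-- **`π̂_t(R₂, N) ≤ (64/(c_Q c_L)) π̂_t(r₀, N)` for `R₂ ≤ 32 r₀ < N`** (monotonicity in the inner
radius, quasi-multiplicativity at `r₀` with `R = 8 r₀`, and `π̂_t(r₀, 8r₀) ≥ c_L 8^{β-2} ≥ c_L/64`).
[cite: WernerPCMI2009, Lecture 6, Cor. 6.2 and §3] -/
theorem unif_outer_fourArm_le (hcQ : 0 < cQ) (hcL : 0 < cL) (hβ : 0 < β)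
    (hrr₀ : r ≤ r₀) (hr₀ : 1 ≤ r₀)
    (hQ : ∀ r' R S : ℕ, r ≤ r' → 16 * r' < 4 * R → 4 * R < S → S ≤ N →
      cQ * (fourArmProbAt t r' R * fourArmProbAt t (4 * R) S) ≤ fourArmProbAt t r' S)
    (hL : ∀ m n : ℕ, r ≤ m → m ≤ n → n ≤ N → cL * ((m : ℝ) / n) ^ (2 - β) ≤ fourArmProbAt t m n)
    {R₂ : ℕ} (hR₂ : R₂ ≤ 32 * r₀) (hN : 32 * r₀ < N) :
    fourArmProbAt t R₂ N ≤ 64 / (cQ * cL) * fourArmProbAt t r₀ N := by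
  set R : ℕ := 8 * r₀ with hR
  have hq := hQ r₀ R N hrr₀ (by omega) (by omega) le_rfl
  have hr0 : (0 : ℝ) < r₀ := by exact_mod_cast (show 0 < r₀ by omega)
  have hlow : cL / 64 ≤ fourArmProbAt t r₀ R := by
    refine le_trans ?_ (hL r₀ R hrr₀ (by omega) (by omega))
    have hrat : ((r₀ : ℝ)) / (R : ℝ) = 1 / 8 := by
      rw [hR]; push_cast; field_simp
    rw [hrat]
    have h1 : ((1 : ℝ) / 8) ^ (2 : ℝ) ≤ ((1 : ℝ) / 8) ^ (2 - β) :=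
      Real.rpow_le_rpow_of_exponent_ge (by norm_num) (by norm_num) (by linarith)
    have h2 : ((1 : ℝ) / 8) ^ (2 : ℝ) = 1 / 64 := by norm_num
    calc cL / 64 = cL * ((1 : ℝ) / 8) ^ (2 : ℝ) := by rw [h2]; ring
      _ ≤ cL * ((1 : ℝ) / 8) ^ (2 - β) := mul_le_mul_of_nonneg_left h1 hcL.le
  have h1 : fourArmProbAt t (4 * R) N ≤ fourArmProbAt t r₀ N / (cQ * (cL / 64)) :=
    le_div_of_quasiMult_left hcQ (by positivity) (fourArmProbAt_nonneg _ _ _) hlow hq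
  calc fourArmProbAt t R₂ N ≤ fourArmProbAt t (4 * R) N := fourArmProbAt_mono_inner t (by omega) (by omega)
    _ ≤ fourArmProbAt t r₀ N / (cQ * (cL / 64)) := h1
    _ = 64 / (cQ * cL) * fourArmProbAt t r₀ N := by field_simp

/-! ### Sites near `∂Λ_{r₀}` without boundary effect (the inner four arms dropped) -/

/-- **Near sites** (`r₀ + 2·2^l ≤ |v|_𝕋 = k ≤ 20 r₀`, `l ≥ l₁ + 2`, `40 r₀ + 10 ≤ N`): the three
annuli of `measureReal_isPivotal_fourArm_le` with `R₁ = r₀` (inner factor `≤ 1`), `R₂ = k + 2^l + 1`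
(`π̂_t(R₂, N) ≤ (64/(c_Q c_L)) π̂_t(r₀, N)`, `unif_outer_fourArm_le`) and the local factors
`≤ 2 K_L (4/(c_Q c_L)) (N/2^l)^{2-β} π̂_t(r, N)`. [cite: Nolin2008, §6.2, proof of Thm. 27, Cases 1 and 3 (arXiv 0711.4948: Thm. 26)] [cite: WernerPCMI2009, Lecture 6, §5] -/
theorem unif_pivotal_near (hcQ : 0 < cQ) (hcL : 0 < cL) (hCA : 0 ≤ CA) (hα : 0 < α)
    (hβ : 0 < β) (hβ2 : β ≤ 2) (hr2 : 2 ≤ r) (hrr₀ : r ≤ r₀)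
    (hQ : ∀ r' R S : ℕ, r ≤ r' → 16 * r' < 4 * R → 4 * R < S → S ≤ N →
      cQ * (fourArmProbAt t r' R * fourArmProbAt t (4 * R) S) ≤ fourArmProbAt t r' S)
    (hL : ∀ m n : ℕ, r ≤ m → m ≤ n → n ≤ N → cL * ((m : ℝ) / n) ^ (2 - β) ≤ fourArmProbAt t m n)
    (hA : ∀ (c : Bool) (n M : ℕ), 1 ≤ n → n ≤ M → M ≤ N →
      (triSitePercolation t).real (armEvent ![c] n M) ≤ CA * ((n : ℝ) / M) ^ α)
    {l₁ : ℕ} (hl₁ : 1 ≤ l₁) (hl₁r : 16 * r + 1 ≤ 2 ^ (l₁ + 1)) (hl₁r' : r ≤ 2 ^ (l₁ - 1))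
    {v : Site 2} {k l : ℕ} (hk : triNorm v = k) (hkl : r₀ + 2 * 2 ^ l ≤ k) (hk20 : k ≤ 20 * r₀)
    (hll₁ : l₁ + 2 ≤ l) (hN : 40 * r₀ + 10 ≤ N) :
    (triSitePercolation t).real {ω | IsPivotal (armEvent ![true, false, true, false] r₀ N) v ω} ≤
      (2 * (8 / (cQ * cL) * (1 + CA) + CA +
          CA / cQ * (1 + 1 / (cL * ((r : ℝ) / (2 ^ (l₁ - 1) : ℕ)) ^ (2 - β))) *
            ((2 : ℝ) ^ α / ((2 : ℝ) ^ α - 1))) * (4 / (cQ * cL)) * (64 / (cQ * cL))) *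
        ((N : ℝ) / (2 ^ l : ℕ)) ^ (2 - β) * (fourArmProbAt t r N * fourArmProbAt t r₀ N) := by
  classical
  set KL : ℝ := 8 / (cQ * cL) * (1 + CA) + CA +
    CA / cQ * (1 + 1 / (cL * ((r : ℝ) / (2 ^ (l₁ - 1) : ℕ)) ^ (2 - β))) *
      ((2 : ℝ) ^ α / ((2 : ℝ) ^ α - 1)) with hKL
  have hr0 : (0 : ℝ) < r := by exact_mod_cast (show 0 < r by omega)
  have hy1 : 1 < (2 : ℝ) ^ α := Real.one_lt_rpow (by norm_num) hα
  have hKL0 : 0 ≤ KL := by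
    rw [hKL]
    have : 0 < cL * ((r : ℝ) / (2 ^ (l₁ - 1) : ℕ)) ^ (2 - β) :=
      mul_pos hcL (Real.rpow_pos_of_pos (div_pos hr0 (by positivity)) _)
    have : 0 ≤ (2 : ℝ) ^ α / ((2 : ℝ) ^ α - 1) := div_nonneg (by positivity) (by linarith)
    positivity
  obtain ⟨M, hM⟩ : ∃ M : ℕ, M = 2 ^ l := ⟨_, rfl⟩
  have hl1 : 1 ≤ l := by omega
  have h2l : 32 * r + 2 ≤ 2 ^ l := by
    have h1 : 2 ^ (l₁ + 2) ≤ 2 ^ l := Nat.pow_le_pow_right (by norm_num) hll₁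
    have h2 : 2 ^ (l₁ + 2) = 2 * 2 ^ (l₁ + 1) := by rw [pow_succ]; ring
    omega
  have hr₀1 : 1 ≤ r₀ := by omega
  set R₂ : ℕ := k + M + 1 with hR₂
  have hkv : (triNorm v : ℤ) = k := hk
  have hcastM : ((2 : ℤ) ^ l) = ((M : ℕ) : ℤ) := by rw [hM]; push_cast; ring
  -- the three annuli with `R₁ = r₀`
  have h3 := measureReal_isPivotal_fourArm_le t (r₀ := r₀) (N := N) (v := v) (R₁ := r₀) (R₂ := R₂)
    hl1 (by rw [hkv, hcastM]; omega) (by rw [hkv, hcastM]; omega)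
    le_rfl (by rw [hkv, hcastM]; omega) (by rw [hkv, hcastM]; omega) (by omega)
  -- the local factors
  have hMN : 2 ^ (l + 2) ≤ N := by
    have : 2 ^ (l + 2) = 4 * 2 ^ l := by rw [pow_add]; ring
    omega
  have hloc : ∀ c : Bool, fourArmProbAt t 1 (2 ^ (l - 1)) +
      (triSitePercolation t).real (armEvent ![c, c, c, c, !c, !c] 2 (2 ^ l)) +
      ∑ l' ∈ Finset.Ico 1 l, fourArmProbAt t 1 (2 ^ (l' - 1)) *
        (triSitePercolation t).real (armEvent ![c, c, c, c, !c, !c] (2 ^ (l' + 1)) (2 ^ l)) ≤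
      KL * fourArmProbAt t r (2 ^ l) := fun c =>
    local_factor_le hcQ hcL hCA hα hβ hr2 hQ hL hA hl₁ hl₁r hl₁r' c hll₁ hMN
  have hsum : ∑ c : Bool, (fourArmProbAt t 1 (2 ^ (l - 1)) +
      (triSitePercolation t).real (armEvent ![c, c, c, c, !c, !c] 2 (2 ^ l)) +
      ∑ l' ∈ Finset.Ico 1 l, fourArmProbAt t 1 (2 ^ (l' - 1)) *
        (triSitePercolation t).real (armEvent ![c, c, c, c, !c, !c] (2 ^ (l' + 1)) (2 ^ l))) ≤
      2 * KL * fourArmProbAt t r (2 ^ l) := by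
    rw [Fintype.sum_bool]
    have h₁ := hloc true
    have h₂ := hloc false
    linarith
  -- the outer factor
  have hout : fourArmProbAt t R₂ N ≤ 64 / (cQ * cL) * fourArmProbAt t r₀ N :=
    unif_outer_fourArm_le hcQ hcL hβ hrr₀ hr₀1 hQ hL (by omega) (by omega)
  -- the local four-arm probability against `π̂(r, N)`
  have hQr : ∀ R S : ℕ, 16 * r < 4 * R → 4 * R < S → S ≤ N →
      cQ * (fourArmProbAt t r R * fourArmProbAt t (4 * R) S) ≤ fourArmProbAt t r S :=
    fun R S h1 h2 h3 => hQ r R S le_rfl h1 h2 h3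
  have hπr : fourArmProbAt t r (2 ^ l) ≤ 4 / (cQ * cL) * ((N : ℝ) / (2 ^ l : ℕ)) ^ (2 - β) *
      fourArmProbAt t r N :=
    fourArmProbAt_le_ratio_mul (rL := r) hcQ hcL hβ hβ2 hQr hL (by omega) (by omega)
      (d := 2 ^ l) (by omega) (by omega) (by omega)
  -- assemble
  have hπN := fourArmProbAt_nonneg t r₀ N
  have hin1 : fourArmProbAt t r₀ r₀ ≤ 1 := fourArmProbAt_le_one t r₀ r₀
  calc (triSitePercolation t).real {ω | IsPivotal (armEvent ![true, false, true, false] r₀ N) v ω}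
      ≤ fourArmProbAt t r₀ r₀ * fourArmProbAt t R₂ N * (2 * KL * fourArmProbAt t r (2 ^ l)) :=
        h3.trans (mul_le_mul_of_nonneg_left hsum
          (mul_nonneg (fourArmProbAt_nonneg _ _ _) (fourArmProbAt_nonneg _ _ _)))
    _ ≤ 1 * (64 / (cQ * cL) * fourArmProbAt t r₀ N) *
          (2 * KL * (4 / (cQ * cL) * ((N : ℝ) / (2 ^ l : ℕ)) ^ (2 - β) * fourArmProbAt t r N)) := by
        refine mul_le_mul (mul_le_mul hin1 hout (fourArmProbAt_nonneg _ _ _) zero_le_one) ?_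
          (mul_nonneg (mul_nonneg (by norm_num) hKL0) (fourArmProbAt_nonneg _ _ _))
          (mul_nonneg zero_le_one (mul_nonneg (by positivity) hπN))
        exact mul_le_mul_of_nonneg_left hπr (by positivity)
    _ = 2 * KL * (4 / (cQ * cL)) * (64 / (cQ * cL)) * ((N : ℝ) / (2 ^ l : ℕ)) ^ (2 - β) *
          (fourArmProbAt t r N * fourArmProbAt t r₀ N) := by
        ring

/-! ### The inner boundary layer away from the corners -/

/-- **Deep sites of the inner layer** (`|v|_𝕋 = k = r₀ + d'`, `2·2^l ≤ d' ≤ r₀`, `l ≥ l₁ + 2`,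
`n₀ ≤ d'`, half-plane annulus up to `D` with `2^l + 2d' + 2 ≤ D`, `2D ≤ k`, `k + 2D ≤ N`,
`k + D + 1 ≤ 32 r₀`, `40 r₀ ≤ N`, and the half-plane hypothesis `hdom`): the three factors of
`measureReal_isPivotal_fourArm_innerBoundary_le` (`d₂ = 2^l + 1`, `R₂ = k + D + 1`) are bounded by
`C_H (d₂ + d')/(D - d') ≤ 4 C_H d'/D`, `(64/(c_Q c_L)) π̂_t(r₀, N)` and
`2 K_L (4/(c_Q c_L)) (N/2^l)^{2-β} π̂_t(r, N)`. [cite: Nolin2008, §4.6 and §6.2, proof of Thm. 27, Case 1 (arXiv 0711.4948: Thm. 26)] [cite: WernerPCMI2009, Lecture 6, §5 and proof of Lemma 6.2 (boundary contributions)] -/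
theorem unif_pivotal_innerDeep (hcQ : 0 < cQ) (hcL : 0 < cL) (hCA : 0 ≤ CA) (hCH : 0 ≤ CH)
    (hα : 0 < α) (hβ : 0 < β) (hβ2 : β ≤ 2) (hr2 : 2 ≤ r) (hrr₀ : r ≤ r₀)
    (hQ : ∀ r' R S : ℕ, r ≤ r' → 16 * r' < 4 * R → 4 * R < S → S ≤ N →
      cQ * (fourArmProbAt t r' R * fourArmProbAt t (4 * R) S) ≤ fourArmProbAt t r' S)
    (hL : ∀ m n : ℕ, r ≤ m → m ≤ n → n ≤ N → cL * ((m : ℝ) / n) ^ (2 - β) ≤ fourArmProbAt t m n)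
    (hA : ∀ (c : Bool) (n M : ℕ), 1 ≤ n → n ≤ M → M ≤ N →
      (triSitePercolation t).real (armEvent ![c] n M) ≤ CA * ((n : ℝ) / M) ^ α)
    {n₀ : ℕ} (hH : ∀ m n : ℕ, n₀ ≤ m → m ≤ n → n ≤ N →
      (triSitePercolation t).real (domArmEvent ![true, false] m n upperHalfPlane) ≤ CH * ((m : ℝ) / n))
    {l₁ : ℕ} (hl₁ : 1 ≤ l₁) (hl₁r : 16 * r + 1 ≤ 2 ^ (l₁ + 1)) (hl₁r' : r ≤ 2 ^ (l₁ - 1))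
    {v : Site 2} {k d' l D : ℕ} (hk : triNorm v = k) (hkr : r₀ + d' = k)
    (hdl : 2 * 2 ^ l ≤ d') (hll₁ : l₁ + 2 ≤ l) (hn₀ : n₀ ≤ d') (hDrec : 2 ^ l + 2 * d' + 2 ≤ D)
    (h2D : 2 * D ≤ k) (hDN : k + 2 * D ≤ N) (hD32 : k + D + 1 ≤ 32 * r₀) (hN : 40 * r₀ ≤ N)
    (hdom : ∃ (j : ℕ) (tt : Site 2), triNorm tt = d' ∧
      ∀ w : Site 2, (r₀ : ℤ) ≤ triNorm (w + v) → triNorm w ≤ D → w - tt ∈ (triRotIsoPow j) '' upperHalfPlane) :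
    (triSitePercolation t).real {ω | IsPivotal (armEvent ![true, false, true, false] r₀ N) v ω} ≤
      (4 * CH * (64 / (cQ * cL)) * (2 * (8 / (cQ * cL) * (1 + CA) + CA +
          CA / cQ * (1 + 1 / (cL * ((r : ℝ) / (2 ^ (l₁ - 1) : ℕ)) ^ (2 - β))) *
            ((2 : ℝ) ^ α / ((2 : ℝ) ^ α - 1))) * (4 / (cQ * cL)))) *
        (((N : ℝ) / (2 ^ l : ℕ)) ^ (2 - β) * ((d' : ℝ) / D)) *
        (fourArmProbAt t r N * fourArmProbAt t r₀ N) := by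
  classical
  set KL : ℝ := 8 / (cQ * cL) * (1 + CA) + CA +
    CA / cQ * (1 + 1 / (cL * ((r : ℝ) / (2 ^ (l₁ - 1) : ℕ)) ^ (2 - β))) *
      ((2 : ℝ) ^ α / ((2 : ℝ) ^ α - 1)) with hKL
  have hr0 : (0 : ℝ) < r := by exact_mod_cast (show 0 < r by omega)
  have hy1 : 1 < (2 : ℝ) ^ α := Real.one_lt_rpow (by norm_num) hα
  have hKL0 : 0 ≤ KL := by
    rw [hKL]
    have : 0 < cL * ((r : ℝ) / (2 ^ (l₁ - 1) : ℕ)) ^ (2 - β) :=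
      mul_pos hcL (Real.rpow_pos_of_pos (div_pos hr0 (by positivity)) _)
    have : 0 ≤ (2 : ℝ) ^ α / ((2 : ℝ) ^ α - 1) := div_nonneg (by positivity) (by linarith)
    positivity
  have hl1 : 1 ≤ l := by omega
  have h2l : 32 * r + 2 ≤ 2 ^ l := by
    have h1 : 2 ^ (l₁ + 2) ≤ 2 ^ l := Nat.pow_le_pow_right (by norm_num) hll₁
    have h2 : 2 ^ (l₁ + 2) = 2 * 2 ^ (l₁ + 1) := by rw [pow_succ]; ring
    omega
  have hr₀1 : 1 ≤ r₀ := by omega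
  have hd0 : (0 : ℝ) < d' := by exact_mod_cast (show 0 < d' by omega)
  have hD0 : (0 : ℝ) < D := by exact_mod_cast (show 0 < D by omega)
  have hN0 : (0 : ℝ) < N := by exact_mod_cast (show 0 < N by omega)
  set d₂ : ℕ := 2 ^ l + 1 with hd₂
  set R₂ : ℕ := k + D + 1 with hR₂
  have h3 := measureReal_isPivotal_fourArm_innerBoundary_le t (r₀ := r₀) (N := N) (l := l) (D := D)
    (d₂ := d₂) (k := k) (d' := d') (R₂ := R₂) hk hkr hr₀1 hl1 hdl (by omega) h2D (by omega)
    (by omega) hDN (by omega) (by omega) hdom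
  -- (i) the mixed pair
  have hdom' : (triSitePercolation t).real
      (domArmEvent ![true, false] (d₂ + d') (D - d') upperHalfPlane) ≤ 4 * CH * ((d' : ℝ) / D) := by
    refine (hH (d₂ + d') (D - d') (by omega) (by omega) (by omega)).trans ?_
    have hden : (0 : ℝ) < ((D - d' : ℕ) : ℝ) := by exact_mod_cast (show 0 < D - d' by omega)
    have hrat : (((d₂ + d' : ℕ) : ℝ)) / ((D - d' : ℕ) : ℝ) ≤ 4 * ((d' : ℝ) / D) := by
      rw [div_le_iff₀ hden, mul_div_assoc', div_mul_eq_mul_div, le_div_iff₀ hD0]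
      have h1 : ((d₂ + d' : ℕ) : ℝ) ≤ 2 * d' := by
        exact_mod_cast (show d₂ + d' ≤ 2 * d' by omega)
      have h2 : (D : ℝ) ≤ 2 * ((D - d' : ℕ) : ℝ) := by
        push_cast [Nat.cast_sub (show d' ≤ D by omega)]
        have : (2 * (d' : ℝ)) ≤ D := by exact_mod_cast (show 2 * d' ≤ D by omega)
        linarith
      nlinarith [hd0.le, hden.le]
    calc CH * ((((d₂ + d' : ℕ) : ℝ)) / ((D - d' : ℕ) : ℝ)) ≤ CH * (4 * ((d' : ℝ) / D)) :=
          mul_le_mul_of_nonneg_left hrat hCH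
      _ = 4 * CH * ((d' : ℝ) / D) := by ring
  -- (ii) the outer four arms
  have hout : fourArmProbAt t R₂ N ≤ 64 / (cQ * cL) * fourArmProbAt t r₀ N :=
    unif_outer_fourArm_le hcQ hcL hβ hrr₀ hr₀1 hQ hL hD32 (by omega)
  -- (iii) the local factors
  have hMN : 2 ^ (l + 2) ≤ N := by
    have : 2 ^ (l + 2) = 4 * 2 ^ l := by rw [pow_add]; ring
    omega
  have hloc : ∀ c : Bool, fourArmProbAt t 1 (2 ^ (l - 1)) +
      (triSitePercolation t).real (armEvent ![c, c, c, c, !c, !c] 2 (2 ^ l)) +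
      ∑ l' ∈ Finset.Ico 1 l, fourArmProbAt t 1 (2 ^ (l' - 1)) *
        (triSitePercolation t).real (armEvent ![c, c, c, c, !c, !c] (2 ^ (l' + 1)) (2 ^ l)) ≤
      KL * fourArmProbAt t r (2 ^ l) := fun c =>
    local_factor_le hcQ hcL hCA hα hβ hr2 hQ hL hA hl₁ hl₁r hl₁r' c hll₁ hMN
  have hsum : ∑ c : Bool, (fourArmProbAt t 1 (2 ^ (l - 1)) +
      (triSitePercolation t).real (armEvent ![c, c, c, c, !c, !c] 2 (2 ^ l)) +
      ∑ l' ∈ Finset.Ico 1 l, fourArmProbAt t 1 (2 ^ (l' - 1)) *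
        (triSitePercolation t).real (armEvent ![c, c, c, c, !c, !c] (2 ^ (l' + 1)) (2 ^ l))) ≤
      2 * KL * fourArmProbAt t r (2 ^ l) := by
    rw [Fintype.sum_bool]
    have h₁ := hloc true
    have h₂ := hloc false
    linarith
  have hQr : ∀ R S : ℕ, 16 * r < 4 * R → 4 * R < S → S ≤ N →
      cQ * (fourArmProbAt t r R * fourArmProbAt t (4 * R) S) ≤ fourArmProbAt t r S :=
    fun R S h1 h2 h3 => hQ r R S le_rfl h1 h2 h3
  have hπr : fourArmProbAt t r (2 ^ l) ≤ 4 / (cQ * cL) * ((N : ℝ) / (2 ^ l : ℕ)) ^ (2 - β) *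
      fourArmProbAt t r N :=
    fourArmProbAt_le_ratio_mul (rL := r) hcQ hcL hβ hβ2 hQr hL (by omega) (by omega)
      (d := 2 ^ l) (by omega) (by omega) (by omega)
  have hπN := fourArmProbAt_nonneg t r₀ N
  have hπNr := fourArmProbAt_nonneg t r N
  have hlocN : 2 * KL * fourArmProbAt t r (2 ^ l) ≤
      2 * KL * (4 / (cQ * cL)) * ((N : ℝ) / (2 ^ l : ℕ)) ^ (2 - β) * fourArmProbAt t r N := by
    calc 2 * KL * fourArmProbAt t r (2 ^ l)
        ≤ 2 * KL * (4 / (cQ * cL) * ((N : ℝ) / (2 ^ l : ℕ)) ^ (2 - β) * fourArmProbAt t r N) :=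
          mul_le_mul_of_nonneg_left hπr (by positivity)
      _ = 2 * KL * (4 / (cQ * cL)) * ((N : ℝ) / (2 ^ l : ℕ)) ^ (2 - β) * fourArmProbAt t r N := by ring
  -- assemble
  have hS0 : 0 ≤ ∑ c : Bool, (fourArmProbAt t 1 (2 ^ (l - 1)) +
      (triSitePercolation t).real (armEvent ![c, c, c, c, !c, !c] 2 (2 ^ l)) +
      ∑ l' ∈ Finset.Ico 1 l, fourArmProbAt t 1 (2 ^ (l' - 1)) *
        (triSitePercolation t).real (armEvent ![c, c, c, c, !c, !c] (2 ^ (l' + 1)) (2 ^ l))) := by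
    refine Finset.sum_nonneg fun c _ => add_nonneg (add_nonneg (fourArmProbAt_nonneg _ _ _)
      measureReal_nonneg) (Finset.sum_nonneg fun l' _ => ?_)
    exact mul_nonneg (fourArmProbAt_nonneg _ _ _) measureReal_nonneg
  calc (triSitePercolation t).real {ω | IsPivotal (armEvent ![true, false, true, false] r₀ N) v ω}
      ≤ (triSitePercolation t).real (domArmEvent ![true, false] (d₂ + d') (D - d') upperHalfPlane) *
          fourArmProbAt t R₂ N *
          ∑ c : Bool, (fourArmProbAt t 1 (2 ^ (l - 1)) +
            (triSitePercolation t).real (armEvent ![c, c, c, c, !c, !c] 2 (2 ^ l)) +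
            ∑ l' ∈ Finset.Ico 1 l, fourArmProbAt t 1 (2 ^ (l' - 1)) *
              (triSitePercolation t).real (armEvent ![c, c, c, c, !c, !c] (2 ^ (l' + 1)) (2 ^ l))) := h3
    _ ≤ (4 * CH * ((d' : ℝ) / D)) * (64 / (cQ * cL) * fourArmProbAt t r₀ N) *
          (2 * KL * (4 / (cQ * cL)) * ((N : ℝ) / (2 ^ l : ℕ)) ^ (2 - β) * fourArmProbAt t r N) := by
        refine mul_le_mul (mul_le_mul hdom' hout (fourArmProbAt_nonneg _ _ _)
          (mul_nonneg (mul_nonneg (by positivity) hCH) (by positivity))) (hsum.trans hlocN) hS0 ?_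
        exact mul_nonneg (mul_nonneg (mul_nonneg (by positivity) hCH) (by positivity)) (by positivity)
    _ = (4 * CH * (64 / (cQ * cL)) * (2 * KL * (4 / (cQ * cL)))) *
          (((N : ℝ) / (2 ^ l : ℕ)) ^ (2 - β) * ((d' : ℝ) / D)) *
          (fourArmProbAt t r N * fourArmProbAt t r₀ N) := by
        ring

/-- **Shallow sites of the inner layer** (`|v|_𝕋 = k = r₀ + d'`, `d' < d₀`, `n₀ ≤ d₀`, `1 ≤ d₀`,
`d₀ + 2d' + 1 ≤ D`, `2D ≤ k`, `k + 2D ≤ N`, `k + D + 1 ≤ 32 r₀ < N`, `hdom`): the two factors of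
`measureReal_isPivotal_fourArm_innerBoundary_two_le` (`d₂ = d₀`, `R₂ = k + D + 1`) are bounded by
`C_H (d₀ + d')/(D - d') ≤ 4 C_H d₀/D` and `(64/(c_Q c_L)) π̂_t(r₀, N)`. [cite: Nolin2008, §4.6 and §6.2, proof of Thm. 27, Case 1 (arXiv 0711.4948: Thm. 26)] [cite: WernerPCMI2009, Lecture 6, proof of Lemma 6.2 (boundary contributions)] -/
theorem unif_pivotal_innerShallow (hcQ : 0 < cQ) (hcL : 0 < cL) (hCH : 0 ≤ CH) (hβ : 0 < β)
    (hrr₀ : r ≤ r₀)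
    (hQ : ∀ r' R S : ℕ, r ≤ r' → 16 * r' < 4 * R → 4 * R < S → S ≤ N →
      cQ * (fourArmProbAt t r' R * fourArmProbAt t (4 * R) S) ≤ fourArmProbAt t r' S)
    (hL : ∀ m n : ℕ, r ≤ m → m ≤ n → n ≤ N → cL * ((m : ℝ) / n) ^ (2 - β) ≤ fourArmProbAt t m n)
    {n₀ : ℕ} (hH : ∀ m n : ℕ, n₀ ≤ m → m ≤ n → n ≤ N →
      (triSitePercolation t).real (domArmEvent ![true, false] m n upperHalfPlane) ≤ CH * ((m : ℝ) / n))
    {v : Site 2} {k d' d₀ D : ℕ} (hk : triNorm v = k) (hkr : r₀ + d' = k) (hr₀ : 1 ≤ r₀)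
    (hd' : d' < d₀) (hn₀ : n₀ ≤ d₀) (hd₀ : 1 ≤ d₀) (hDrec : d₀ + 2 * d' + 1 ≤ D) (h2D : 2 * D ≤ k)
    (hDN : k + 2 * D ≤ N) (hD32 : k + D + 1 ≤ 32 * r₀) (hN : 32 * r₀ < N)
    (hdom : ∃ (j : ℕ) (tt : Site 2), triNorm tt = d' ∧
      ∀ w : Site 2, (r₀ : ℤ) ≤ triNorm (w + v) → triNorm w ≤ D → w - tt ∈ (triRotIsoPow j) '' upperHalfPlane) :
    (triSitePercolation t).real {ω | IsPivotal (armEvent ![true, false, true, false] r₀ N) v ω} ≤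
      (4 * CH * (64 / (cQ * cL))) * ((d₀ : ℝ) / D) * fourArmProbAt t r₀ N := by
  have hd0 : (0 : ℝ) < d₀ := by exact_mod_cast (show 0 < d₀ by omega)
  have hD0 : (0 : ℝ) < D := by exact_mod_cast (show 0 < D by omega)
  set R₂ : ℕ := k + D + 1 with hR₂
  have h2 := measureReal_isPivotal_fourArm_innerBoundary_two_le t (r₀ := r₀) (N := N) (D := D)
    (d₂ := d₀) (k := k) (d' := d') (R₂ := R₂) hk hkr hr₀ (by omega) h2D (by omega) (by omega) hDN
    hd₀ hDrec hdom
  have hout : fourArmProbAt t R₂ N ≤ 64 / (cQ * cL) * fourArmProbAt t r₀ N :=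
    unif_outer_fourArm_le hcQ hcL hβ hrr₀ hr₀ hQ hL hD32 hN
  have hdom' : (triSitePercolation t).real
      (domArmEvent ![true, false] (d₀ + d') (D - d') upperHalfPlane) ≤ 4 * CH * ((d₀ : ℝ) / D) := by
    refine (hH (d₀ + d') (D - d') (by omega) (by omega) (by omega)).trans ?_
    have hden : (0 : ℝ) < ((D - d' : ℕ) : ℝ) := by exact_mod_cast (show 0 < D - d' by omega)
    have hrat : (((d₀ + d' : ℕ) : ℝ)) / ((D - d' : ℕ) : ℝ) ≤ 4 * ((d₀ : ℝ) / D) := by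
      rw [div_le_iff₀ hden, mul_div_assoc', div_mul_eq_mul_div, le_div_iff₀ hD0]
      have h1 : ((d₀ + d' : ℕ) : ℝ) ≤ 2 * d₀ := by
        exact_mod_cast (show d₀ + d' ≤ 2 * d₀ by omega)
      have h2 : (D : ℝ) ≤ 2 * ((D - d' : ℕ) : ℝ) := by
        push_cast [Nat.cast_sub (show d' ≤ D by omega)]
        have : (2 * (d' : ℝ)) ≤ D := by exact_mod_cast (show 2 * d' ≤ D by omega)
        linarith
      nlinarith [hd0.le, hden.le]
    calc CH * ((((d₀ + d' : ℕ) : ℝ)) / ((D - d' : ℕ) : ℝ)) ≤ CH * (4 * ((d₀ : ℝ) / D)) :=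
          mul_le_mul_of_nonneg_left hrat hCH
      _ = 4 * CH * ((d₀ : ℝ) / D) := by ring
  calc (triSitePercolation t).real {ω | IsPivotal (armEvent ![true, false, true, false] r₀ N) v ω}
      ≤ (triSitePercolation t).real (domArmEvent ![true, false] (d₀ + d') (D - d') upperHalfPlane) *
          fourArmProbAt t R₂ N := h2
    _ ≤ (4 * CH * ((d₀ : ℝ) / D)) * (64 / (cQ * cL) * fourArmProbAt t r₀ N) :=
        mul_le_mul hdom' hout (fourArmProbAt_nonneg _ _ _)
          (mul_nonneg (mul_nonneg (by positivity) hCH) (by positivity))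
    _ = (4 * CH * (64 / (cQ * cL))) * ((d₀ : ℝ) / D) * fourArmProbAt t r₀ N := by ring

/-! ### The outer boundary layer -/

/-- **Deep sites of the outer layer, uniformly in the inner radius** (`|v|_𝕋 = k`, `k + d' = N`,
`8·2^l ≤ d' < 16·2^l`, `10 d' ≤ N`, `D = ⌊2N/5⌋`, `200 r₀ + 400 ≤ N`): `fourArm_pivotal_bound_deep`
with the conversion of the local factor at the reference radius `r`. [cite: WernerPCMI2009, Lecture 6, §5 and proof of Lemma 6.2 (boundary contributions)] [cite: Nolin2008, §4.6 and §6.2, proof of Thm. 27, Case 2 (arXiv 0711.4948: Thm. 26)] -/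

theorem unif_pivotal_deep (hcQ : 0 < cQ) (hcL : 0 < cL) (hCA : 0 ≤ CA) (hCH : 0 ≤ CH)
    (hα : 0 < α) (hβ : 0 < β) (hβ2 : β ≤ 2) (hr2 : 2 ≤ r) (hrr₀ : r ≤ r₀)
    (hQ : ∀ r' R S : ℕ, r ≤ r' → 16 * r' < 4 * R → 4 * R < S → S ≤ N →
      cQ * (fourArmProbAt t r' R * fourArmProbAt t (4 * R) S) ≤ fourArmProbAt t r' S)
    (hL : ∀ m n : ℕ, r ≤ m → m ≤ n → n ≤ N → cL * ((m : ℝ) / n) ^ (2 - β) ≤ fourArmProbAt t m n)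
    (hA : ∀ (c : Bool) (n M : ℕ), 1 ≤ n → n ≤ M → M ≤ N →
      (triSitePercolation t).real (armEvent ![c] n M) ≤ CA * ((n : ℝ) / M) ^ α)
    {n₀ : ℕ} (hH : ∀ m n : ℕ, n₀ ≤ m → m ≤ n → n ≤ N →
      (triSitePercolation t).real (domArmEvent ![true, false] m n upperHalfPlane) ≤ CH * ((m : ℝ) / n))
    {l₁ : ℕ} (hl₁ : 1 ≤ l₁) (hl₁r : 16 * r + 1 ≤ 2 ^ (l₁ + 1)) (hl₁r' : r ≤ 2 ^ (l₁ - 1))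
    {v : Site 2} {k d' l D : ℕ} (hk : triNorm v = k) (hkN : k + d' = N) (hD : D = 2 * N / 5)
    (hdl : 8 * 2 ^ l ≤ d') (hdl' : d' < 16 * 2 ^ l) (hll₁ : l₁ + 2 ≤ l)
    (hn₀ : n₀ ≤ d') (h10 : 10 * d' ≤ N) (hN : 200 * r₀ + 400 ≤ N) :
    (triSitePercolation t).real {ω | IsPivotal (armEvent ![true, false, true, false] r₀ N) v ω} ≤
      (100 / (cQ * cL) * (11 * CH) * (2 * (8 / (cQ * cL) * (1 + CA) + CA +
          CA / cQ * (1 + 1 / (cL * ((r : ℝ) / (2 ^ (l₁ - 1) : ℕ)) ^ (2 - β))) *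
            ((2 : ℝ) ^ α / ((2 : ℝ) ^ α - 1))) * (1024 / (cQ * cL)))) *
        (((N : ℝ) / ((N - k : ℕ) : ℝ)) ^ (2 - β) * (((N - k : ℕ) : ℝ) / N)) *
        (fourArmProbAt t r N * fourArmProbAt t r₀ N) := by
  classical
  set KL : ℝ := 8 / (cQ * cL) * (1 + CA) + CA +
    CA / cQ * (1 + 1 / (cL * ((r : ℝ) / (2 ^ (l₁ - 1) : ℕ)) ^ (2 - β))) *
      ((2 : ℝ) ^ α / ((2 : ℝ) ^ α - 1)) with hKL
  have hr0 : (0 : ℝ) < r := by exact_mod_cast (show 0 < r by omega)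
  have hy1 : 1 < (2 : ℝ) ^ α := Real.one_lt_rpow (by norm_num) hα
  have hKL0 : 0 ≤ KL := by
    rw [hKL]
    have : 0 < cL * ((r : ℝ) / (2 ^ (l₁ - 1) : ℕ)) ^ (2 - β) :=
      mul_pos hcL (Real.rpow_pos_of_pos (div_pos hr0 (by positivity)) _)
    have : 0 ≤ (2 : ℝ) ^ α / ((2 : ℝ) ^ α - 1) := div_nonneg (by positivity) (by linarith)
    positivity
  have hdk : N - k = d' := by omega
  rw [hdk]
  have hN0 : (0 : ℝ) < N := by exact_mod_cast (show 0 < N by omega)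
  have hd0 : (0 : ℝ) < d' := by exact_mod_cast (show 0 < d' by omega)
  have hl1 : 1 ≤ l := by omega
  have h2l : 32 * r + 2 ≤ 2 ^ l := by
    have h1 : 2 ^ (l₁ + 2) ≤ 2 ^ l := Nat.pow_le_pow_right (by norm_num) hll₁
    have h2 : 2 ^ (l₁ + 2) = 2 * 2 ^ (l₁ + 1) := by rw [pow_succ]; ring
    omega
  -- the three factors
  set m₀ : ℕ := k - D - 1 with hm₀
  set d₂ : ℕ := 2 ^ l + 1 with hd₂
  have h3 := measureReal_isPivotal_fourArm_boundary_le t (r₀ := r₀) (l := l) (m₀ := m₀) (D := D)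
    (d₂ := d₂) hk hkN hl1 (by omega) (by omega) (by omega) (by omega) (by omega) (by omega)
    (by omega) (by omega)
  -- (i) inner
  have hin : fourArmProbAt t r₀ m₀ ≤ 100 / (cQ * cL) * fourArmProbAt t r₀ N :=
    fourArmProbAt_inner_le hcQ hcL hβ hrr₀ hQ hL hN (by omega)
  -- (ii) the mixed pair
  have hdom : (triSitePercolation t).real
      (domArmEvent ![true, false] (d₂ + d') (D - d') upperHalfPlane) ≤ 11 * CH * ((d' : ℝ) / N) := by
    refine (hH (d₂ + d') (D - d') (by omega) (by omega) (by omega)).trans ?_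
    have hrat := layer_ratio_le (N := N) (D := D) (d' := d') (by omega) hD (by omega) h10
    have hle : (((d₂ + d' : ℕ) : ℝ)) / ((D - d' : ℕ) : ℝ) ≤ ((2 * d' + 1 : ℕ) : ℝ) / ((D - d' : ℕ) : ℝ) := by
      apply div_le_div_of_nonneg_right _ (by positivity)
      exact_mod_cast (show d₂ + d' ≤ 2 * d' + 1 by omega)
    calc CH * ((((d₂ + d' : ℕ) : ℝ)) / ((D - d' : ℕ) : ℝ)) ≤ CH * (11 * ((d' : ℝ) / N)) :=
          mul_le_mul_of_nonneg_left (hle.trans hrat) hCH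
      _ = 11 * CH * ((d' : ℝ) / N) := by ring
  -- (iii) the local factors
  have hMN : 2 ^ (l + 2) ≤ N := by
    have : 2 ^ (l + 2) = 4 * 2 ^ l := by rw [pow_add]; ring
    omega
  have hloc : ∀ c : Bool, fourArmProbAt t 1 (2 ^ (l - 1)) +
      (triSitePercolation t).real (armEvent ![c, c, c, c, !c, !c] 2 (2 ^ l)) +
      ∑ l' ∈ Finset.Ico 1 l, fourArmProbAt t 1 (2 ^ (l' - 1)) *
        (triSitePercolation t).real (armEvent ![c, c, c, c, !c, !c] (2 ^ (l' + 1)) (2 ^ l)) ≤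
      KL * fourArmProbAt t r (2 ^ l) := fun c =>
    local_factor_le hcQ hcL hCA hα hβ hr2 hQ hL hA hl₁ hl₁r hl₁r' c hll₁ hMN
  have hsum : ∑ c : Bool, (fourArmProbAt t 1 (2 ^ (l - 1)) +
      (triSitePercolation t).real (armEvent ![c, c, c, c, !c, !c] 2 (2 ^ l)) +
      ∑ l' ∈ Finset.Ico 1 l, fourArmProbAt t 1 (2 ^ (l' - 1)) *
        (triSitePercolation t).real (armEvent ![c, c, c, c, !c, !c] (2 ^ (l' + 1)) (2 ^ l))) ≤
      2 * KL * fourArmProbAt t r (2 ^ l) := by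
    rw [Fintype.sum_bool]
    have h₁ := hloc true
    have h₂ := hloc false
    linarith
  have hQr : ∀ R S : ℕ, 16 * r < 4 * R → 4 * R < S → S ≤ N →
      cQ * (fourArmProbAt t r R * fourArmProbAt t (4 * R) S) ≤ fourArmProbAt t r S :=
    fun R S h1 h2 h3 => hQ r R S le_rfl h1 h2 h3
  have hπr : fourArmProbAt t r (2 ^ l) ≤ 4 / (cQ * cL) * ((N : ℝ) / (2 ^ l : ℕ)) ^ (2 - β) *
      fourArmProbAt t r N :=
    fourArmProbAt_le_ratio_mul (rL := r) hcQ hcL hβ hβ2 hQr hL (by omega) (by omega)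
      (d := 2 ^ l) (by omega) (by omega) (by omega)
  have hexp : (0 : ℝ) ≤ 2 - β := by linarith
  have hpow : ((N : ℝ) / (2 ^ l : ℕ)) ^ (2 - β) ≤ 256 * ((N : ℝ) / d') ^ (2 - β) := by
    have hle : (N : ℝ) / (2 ^ l : ℕ) ≤ 16 * ((N : ℝ) / d') := by
      rw [mul_div_assoc', div_le_div_iff₀ (by positivity) hd0]
      have : (d' : ℝ) ≤ 16 * ((2 ^ l : ℕ) : ℝ) := by exact_mod_cast hdl'.le
      nlinarith [hN0]
    calc ((N : ℝ) / (2 ^ l : ℕ)) ^ (2 - β) ≤ (16 * ((N : ℝ) / d')) ^ (2 - β) :=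
          Real.rpow_le_rpow (by positivity) hle hexp
      _ = (16 : ℝ) ^ (2 - β) * ((N : ℝ) / d') ^ (2 - β) := Real.mul_rpow (by norm_num) (by positivity)
      _ ≤ 256 * ((N : ℝ) / d') ^ (2 - β) := by
          apply mul_le_mul_of_nonneg_right _ (by positivity)
          calc (16 : ℝ) ^ (2 - β) ≤ (16 : ℝ) ^ (2 : ℝ) :=
                Real.rpow_le_rpow_of_exponent_le (by norm_num) (by linarith)
            _ = 256 := by norm_num
  have hπN := fourArmProbAt_nonneg t r₀ N
  have hπNr := fourArmProbAt_nonneg t r N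
  have hlocN : 2 * KL * fourArmProbAt t r (2 ^ l) ≤
      2 * KL * (4 / (cQ * cL)) * 256 * ((N : ℝ) / d') ^ (2 - β) * fourArmProbAt t r N := by
    calc 2 * KL * fourArmProbAt t r (2 ^ l)
        ≤ 2 * KL * (4 / (cQ * cL) * ((N : ℝ) / (2 ^ l : ℕ)) ^ (2 - β) * fourArmProbAt t r N) :=
          mul_le_mul_of_nonneg_left hπr (by positivity)
      _ ≤ 2 * KL * (4 / (cQ * cL) * (256 * ((N : ℝ) / d') ^ (2 - β)) * fourArmProbAt t r N) := by
          apply mul_le_mul_of_nonneg_left _ (by positivity)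
          exact mul_le_mul_of_nonneg_right (mul_le_mul_of_nonneg_left hpow (by positivity)) hπNr
      _ = 2 * KL * (4 / (cQ * cL)) * 256 * ((N : ℝ) / d') ^ (2 - β) * fourArmProbAt t r N := by ring
  -- assemble
  have hX0 : (0 : ℝ) ≤ ((N : ℝ) / d') ^ (2 - β) := by positivity
  have hS0 : 0 ≤ ∑ c : Bool, (fourArmProbAt t 1 (2 ^ (l - 1)) +
      (triSitePercolation t).real (armEvent ![c, c, c, c, !c, !c] 2 (2 ^ l)) +
      ∑ l' ∈ Finset.Ico 1 l, fourArmProbAt t 1 (2 ^ (l' - 1)) *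
        (triSitePercolation t).real (armEvent ![c, c, c, c, !c, !c] (2 ^ (l' + 1)) (2 ^ l))) := by
    refine Finset.sum_nonneg fun c _ => add_nonneg (add_nonneg (fourArmProbAt_nonneg _ _ _)
      measureReal_nonneg) (Finset.sum_nonneg fun l' _ => ?_)
    exact mul_nonneg (fourArmProbAt_nonneg _ _ _) measureReal_nonneg
  calc (triSitePercolation t).real {ω | IsPivotal (armEvent ![true, false, true, false] r₀ N) v ω}
      ≤ fourArmProbAt t r₀ m₀ *
          (triSitePercolation t).real (domArmEvent ![true, false] (d₂ + d') (D - d') upperHalfPlane) *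
          ∑ c : Bool, (fourArmProbAt t 1 (2 ^ (l - 1)) +
            (triSitePercolation t).real (armEvent ![c, c, c, c, !c, !c] 2 (2 ^ l)) +
            ∑ l' ∈ Finset.Ico 1 l, fourArmProbAt t 1 (2 ^ (l' - 1)) *
              (triSitePercolation t).real (armEvent ![c, c, c, c, !c, !c] (2 ^ (l' + 1)) (2 ^ l))) := h3
    _ ≤ (100 / (cQ * cL) * fourArmProbAt t r₀ N) * (11 * CH * ((d' : ℝ) / N)) *
          (2 * KL * (4 / (cQ * cL)) * 256 * ((N : ℝ) / d') ^ (2 - β) * fourArmProbAt t r N) := by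
        refine mul_le_mul (mul_le_mul hin hdom measureReal_nonneg
          (mul_nonneg (by positivity) hπN)) (hsum.trans hlocN) hS0 ?_
        exact mul_nonneg (mul_nonneg (by positivity) hπN) (by positivity)
    _ = (100 / (cQ * cL) * (11 * CH) * (2 * KL * (1024 / (cQ * cL)))) *
          (((N : ℝ) / d') ^ (2 - β) * ((d' : ℝ) / N)) * (fourArmProbAt t r N * fourArmProbAt t r₀ N) := by
        ring


/-- **Middle sites of the outer layer, uniformly in the inner radius** (`N/2 < |v|_𝕋 = k`,
`16 r₀ ≤ k`, depth `d' = N - k ≥ N/10 - 1`, `64·2^l ≤ d' < 128·2^l`): `unif_pivotal_core` with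
`(N/2^l)^{2-β} ≤ 2048²`. [cite: WernerPCMI2009, Lecture 6, §5 ("the three annuli")] -/

theorem unif_pivotal_middle (hcQ : 0 < cQ) (hcL : 0 < cL) (hCA : 0 ≤ CA) (hα : 0 < α)
    (hβ : 0 < β) (hβ2 : β ≤ 2) (hr2 : 2 ≤ r) (hrr₀ : r ≤ r₀)
    (hQ : ∀ r' R S : ℕ, r ≤ r' → 16 * r' < 4 * R → 4 * R < S → S ≤ N →
      cQ * (fourArmProbAt t r' R * fourArmProbAt t (4 * R) S) ≤ fourArmProbAt t r' S)
    (hL : ∀ m n : ℕ, r ≤ m → m ≤ n → n ≤ N → cL * ((m : ℝ) / n) ^ (2 - β) ≤ fourArmProbAt t m n)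
    (hA : ∀ (c : Bool) (n M : ℕ), 1 ≤ n → n ≤ M → M ≤ N →
      (triSitePercolation t).real (armEvent ![c] n M) ≤ CA * ((n : ℝ) / M) ^ α)
    {l₁ : ℕ} (hl₁ : 1 ≤ l₁) (hl₁r : 16 * r + 1 ≤ 2 ^ (l₁ + 1)) (hl₁r' : r ≤ 2 ^ (l₁ - 1))
    {v : Site 2} {k d' l : ℕ} (hk : triNorm v = k) (hkN : k + d' = N) (h2k : N < 2 * k)
    (hdl : 64 * 2 ^ l ≤ d') (hdl' : d' < 128 * 2 ^ l) (hll₁ : l₁ + 2 ≤ l) (hkr₀ : 16 * r₀ ≤ k)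
    (h10 : N ≤ 10 * d' + 10) :
    (triSitePercolation t).real {ω | IsPivotal (armEvent ![true, false, true, false] r₀ N) v ω} ≤
      (2 * (8 / (cQ * cL) * (1 + CA) + CA +
          CA / cQ * (1 + 1 / (cL * ((r : ℝ) / (2 ^ (l₁ - 1) : ℕ)) ^ (2 - β))) *
            ((2 : ℝ) ^ α / ((2 : ℝ) ^ α - 1))) / cQ * (4 / (cQ * cL)) * 4194304) *
        (fourArmProbAt t r N * fourArmProbAt t r₀ N) := by
  have h := unif_pivotal_core hcQ hcL hCA hα hβ hβ2 hr2 hrr₀ hQ hL hA hl₁ hl₁r hl₁r' hk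
    (by omega) hll₁ hkr₀ (by omega)
  have hN0 : (0 : ℝ) < N := by exact_mod_cast (show 0 < N by omega)
  have hM0 : (0 : ℝ) < ((2 ^ l : ℕ) : ℝ) := by positivity
  have hexp : (0 : ℝ) ≤ 2 - β := by linarith
  have hbase : (N : ℝ) / (2 ^ l : ℕ) ≤ 2048 := by
    rw [div_le_iff₀ hM0]
    exact_mod_cast (show N ≤ 2048 * 2 ^ l by omega)
  have hbase1 : (1 : ℝ) ≤ (N : ℝ) / (2 ^ l : ℕ) := by
    rw [le_div_iff₀ hM0, one_mul]
    exact_mod_cast (show 2 ^ l ≤ N by omega)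
  have hpow : ((N : ℝ) / (2 ^ l : ℕ)) ^ (2 - β) ≤ 4194304 := by
    calc ((N : ℝ) / (2 ^ l : ℕ)) ^ (2 - β) ≤ ((N : ℝ) / (2 ^ l : ℕ)) ^ (2 : ℝ) :=
          Real.rpow_le_rpow_of_exponent_le hbase1 (by linarith)
      _ ≤ (2048 : ℝ) ^ (2 : ℝ) := Real.rpow_le_rpow (by positivity) hbase (by norm_num)
      _ = 4194304 := by norm_num
  set KL : ℝ := 8 / (cQ * cL) * (1 + CA) + CA +
    CA / cQ * (1 + 1 / (cL * ((r : ℝ) / (2 ^ (l₁ - 1) : ℕ)) ^ (2 - β))) *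
      ((2 : ℝ) ^ α / ((2 : ℝ) ^ α - 1)) with hKL
  have hr0 : (0 : ℝ) < r := by exact_mod_cast (show 0 < r by omega)
  have hy1 : 1 < (2 : ℝ) ^ α := Real.one_lt_rpow (by norm_num) hα
  have hKL0 : 0 ≤ KL := by
    rw [hKL]
    have : 0 < cL * ((r : ℝ) / (2 ^ (l₁ - 1) : ℕ)) ^ (2 - β) :=
      mul_pos hcL (Real.rpow_pos_of_pos (div_pos hr0 (by positivity)) _)
    have : 0 ≤ (2 : ℝ) ^ α / ((2 : ℝ) ^ α - 1) := div_nonneg (by positivity) (by linarith)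
    positivity
  have hππ : 0 ≤ fourArmProbAt t r N * fourArmProbAt t r₀ N :=
    mul_nonneg (fourArmProbAt_nonneg _ _ _) (fourArmProbAt_nonneg _ _ _)
  calc (triSitePercolation t).real {ω | IsPivotal (armEvent ![true, false, true, false] r₀ N) v ω}
      ≤ 2 * KL / cQ * (4 / (cQ * cL)) * ((N : ℝ) / (2 ^ l : ℕ)) ^ (2 - β) *
          (fourArmProbAt t r N * fourArmProbAt t r₀ N) := h
    _ ≤ 2 * KL / cQ * (4 / (cQ * cL)) * 4194304 * (fourArmProbAt t r N * fourArmProbAt t r₀ N) := by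
        apply mul_le_mul_of_nonneg_right _ hππ
        exact mul_le_mul_of_nonneg_left hpow (by positivity)


end Regimes

end Literature.Probability.Percolation
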